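import Literature.Computability.MetaComplexity.EFPlainComm
import Literature.Computability.MetaComplexity.EFModMulUShift
import HarnessLib

/-!
# Plain ripple-carry arithmetic: the commutativity law of integer multiplication, the stage

Layer P/5 (continued). For the commutativity kit (`EFPlainComm.lean`): the STAGE `t` of the
linearity induction for fixed `k`: from `R_t(M_{k+1}) ≡ U_{k,t}` (bitwise: the partial sum of the
multiplier of `a⁽ᵏ⁺¹⁾` equals `R_t(M_k) + Qw_{k,t}`) derive the same for `t + 1`, using the
interchange kit `F_{k,t}`, the disjoint-sum law (`DOR`) for `mask_t(M_k) + δw` and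
`Qw_{k,t} + δw`, and bitwise identities of the mask gates (`Plain.CommLaw.isBlock_segs`).

## Sources

* S. A. Cook, R. A. Reckhow, *The relative efficiency of propositional proof systems*,
  J. Symbolic Logic 44 (1979), §2.
-/

namespace Literature.Computability.MetaComplexity

open _root_.Computability Complexity Complexity.PropForm Netlist Cluster FregeSystem

namespace Plain

namespace CommLaw

open Comm

/-! ### Rules -/

/-- `[m₁ ↔ m₂, ¬z] ⊢ m₁ ↔ (m₂ ∨ z)`. [cite: CookReckhow1979, §2 (sound rule)] -/
def rOrF : FregeRule := ⟨[ctx (var 0) (eqv 1 2), ctx (var 0) (neg (var 3))], ctx (var 0) (biimp (var 1) (disj (var 2) (var 3)))⟩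
/-- `[¬z] ⊢ x ↔ (x ∨ z)`. [cite: CookReckhow1979, §2 (sound rule)] -/
def rSelfOrF : FregeRule := ⟨[ctx (var 0) (neg (var 2))], ctx (var 0) (biimp (var 1) (disj (var 1) (var 2)))⟩
/-- `[¬z] ⊢ g ↔ (z ∨ g)`. [cite: CookReckhow1979, §2 (sound rule)] -/
def rOrFL : FregeRule := ⟨[ctx (var 0) (neg (var 2))], ctx (var 0) (biimp (var 1) (disj (var 2) (var 1)))⟩
/-- `[m₁ ↔ b ∧ a, m₂ ↔ b ∧ z, ¬z, g ↔ a ∧ b] ⊢ m₁ ↔ (m₂ ∨ g)`. [cite: CookReckhow1979, §2 (sound rule)] -/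
def rMkSwap : FregeRule :=
  ⟨[ctx (var 0) (biimp (var 1) (conj (var 5) (var 6))), ctx (var 0) (biimp (var 2) (conj (var 5) (var 4))), ctx (var 0) (neg (var 4)),
    ctx (var 0) (biimp (var 3) (conj (var 6) (var 5)))], ctx (var 0) (biimp (var 1) (disj (var 2) (var 3)))⟩
/-- `[s ↔ (x ∨ y), m ↔ (x ∨ y)] ⊢ m ↔ s`. [cite: CookReckhow1979, §2 (sound rule)] -/
def rEqvVia : FregeRule :=
  ⟨[ctx (var 0) (biimp (var 1) (disj (var 3) (var 4))), ctx (var 0) (biimp (var 2) (disj (var 3) (var 4)))], ctx (var 0) (eqv 2 1)⟩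
/-- `[¬x] ⊢ ¬(x ∧ y)`. [cite: CookReckhow1979, §2 (sound rule)] -/
def rNotAndL : FregeRule := ⟨[ctx (var 0) (neg (var 1))], ctx (var 0) (neg (conj (var 1) (var 2)))⟩
/-- `[¬y] ⊢ ¬(x ∧ y)`. [cite: CookReckhow1979, §2 (sound rule)] -/
def rNotAndR : FregeRule := ⟨[ctx (var 0) (neg (var 2))], ctx (var 0) (neg (conj (var 1) (var 2)))⟩
/-- `[m₁ ↔ b ∧ x, m₂ ↔ b ∧ x, ¬z] ⊢ m₁ ↔ (m₂ ∨ z)`. [cite: CookReckhow1979, §2 (sound rule)] -/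
def rSameAndOrF : FregeRule :=
  ⟨[ctx (var 0) (biimp (var 1) (conj (var 3) (var 4))), ctx (var 0) (biimp (var 2) (conj (var 3) (var 4))), ctx (var 0) (neg (var 5))],
    ctx (var 0) (biimp (var 1) (disj (var 2) (var 5)))⟩

/-- `[m₁ ↔ b ∧ x, m₂ ↔ b ∧ x] ⊢ m₁ ↔ m₂`. [cite: CookReckhow1979, §2 (sound rule)] -/
def rSameAnd : FregeRule :=
  ⟨[ctx (var 0) (biimp (var 1) (conj (var 3) (var 4))), ctx (var 0) (biimp (var 2) (conj (var 3) (var 4)))], ctx (var 0) (eqv 1 2)⟩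

/-- The rules of this layer. [cite: CookReckhow1979, §2] -/
def rules : List FregeRule := [rOrF, rSelfOrF, rOrFL, rMkSwap, rEqvVia, rNotAndL, rNotAndR, rSameAndOrF, rSameAnd]

/-- Every rule is sound. [cite: CookReckhow1979, §2 (sound rule)] -/
theorem isSound_of_mem_rules : ∀ r ∈ rules, r.IsSound := by
  intro r hr
  simp only [rules, List.mem_cons, List.not_mem_nil, or_false] at hr
  rcases hr with rfl | rfl | rfl | rfl | rfl | rfl | rfl | rfl | rfl <;> exact FregeRule.isSound_of_check (by decide +kernel)

variable {G : FregeSystem} {K : PropForm ℕ} {Γ : Set (PropForm ℕ)} {L : ℕ}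

/-- One-step inference by rule `i`. [folklore] -/
theorem infer (hG : ∀ r ∈ rules, r ∈ G.rules) (i : ℕ) (hi : i < rules.length) {S : Set (PropForm ℕ)}
    (σ : ℕ → PropForm ℕ) {φ : PropForm ℕ} (hφ : (rules[i]).conclusion.subst σ = φ)
    (hp : ∀ ψ ∈ (rules[i]).premises, ψ.subst σ ∈ S) : G.IsInferredFrom S φ :=
  hφ ▸ FregeSystem.IsInferredFrom.of_rule (hG _ (List.getElem_mem hi)) σ rfl hp

/-! ### The words of the stage -/

/-- The values of the shifted operand words of the multipliers. [folklore] -/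
theorem ash_MQ {o : Occ} {k t j : ℕ} (hk : k ≤ L) (hj : j < L) :
    Mul.ash L (MQ L o k) t j = if t ≤ j ∧ j - t < k then o.inp (j - t) else zz L o := by
  obtain ⟨-, e1, -, e3⟩ := MQ_facts (L := L) (o := o) hk
  unfold Mul.ash
  by_cases htj : t ≤ j
  · rw [if_pos htj, e1 _ (by omega)]
    by_cases h : j - t < k
    · rw [if_pos h, if_pos ⟨htj, h⟩]
    · rw [if_neg h, if_neg (by omega)]
  · rw [if_neg htj, if_neg (by omega)]; exact e3

/-- The multiplier bits of the multipliers. [folklore] -/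
theorem bin_MQ {o : Occ} {k t : ℕ} (hk : k ≤ L) (ht : t < L) : Mul.bin L (MQ L o k) t = o.inp (L + t) :=
  (MQ_facts (L := L) (o := o) hk).2.2.1 t ht

/-- `R_0` of a multiplier is the zero gate. [folklore] -/
theorem Rw_zero {o : Occ} {k : ℕ} (hk : k ≤ L) (j : ℕ) : Mul.Rw L (MQ L o k) 0 j = zz L o := by
  unfold Mul.Rw; rw [if_pos rfl]; exact (MQ_facts (L := L) (o := o) hk).2.2.2

section Segs

variable (L : ℕ) (o : Occ) (K : PropForm ℕ) (k t : ℕ)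

/-- `M_k`. [folklore] -/
def Mk : Occ := MQ L o k
/-- `M_{k+1}`. [folklore] -/
def Mk1 : Occ := MQ L o (k + 1)
/-- `F_{k,t}`. [folklore] -/
def F : Occ := FQ L o k t
/-- The adder of piece `m` of `F_{k,t}`. [folklore] -/
def V (m : ℕ) : Adder.View := MFI.V L (F L o k t) m

/-- The lines `m₁ⱼ ↔ (CD.xⱼ ∨ CD.yⱼ)` for the masks of `M_{k+1}`. [folklore] -/
def mkOrLines : List (PropForm ℕ) :=
  (List.range L).map fun j => ctx K (biimp (var (Mul.msk L (Mk1 L o k) t j)) (disj (var ((V L o k t 1).x j)) (var ((V L o k t 1).y j))))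
/-- The lines `Qw_{k,t+1,j} ↔ (BD.xⱼ ∨ BD.yⱼ)`. [folklore] -/
def qwOrLines : List (PropForm ℕ) :=
  (List.range L).map fun j => ctx K (biimp (var (Qw L o k (t + 1) j)) (disj (var ((V L o k t 3).x j)) (var ((V L o k t 3).y j))))
/-- The disjointness lines of an adder. [folklore] -/
def disjLines (S : Adder.View) : List (PropForm ℕ) := (List.range L).map fun j => ctx K (neg (conj (var (S.x j)) (var (S.y j))))

/-- The segments of the stage. [folklore] -/
def segs : List (List (PropForm ℕ)) :=
  [Adder.reflLines K ((List.range L).map (Mul.Rw L (Mk L o k) t) ++ (List.range L).map (Qw L o k t) ++ (List.range L).map (Mul.msk L (Mk L o k) t) ++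
      (List.range L).map (o.inp) ++ (List.range L).map (fun j => o.inp (L + j)) ++ [zz L o]),                       -- 0
   (if k + t < L then [ctx K (neg (var (Mul.msk L (Mk L o k) t (k + t))))] else []),                                 -- 1
   Adder.leibLines (U L o k t) (V L o k t 0) K L,                                                                  -- 2
   ModAddU.MFI.transLines K (Mul.Rw L (Mk1 L o k) t) ((V L o k t 0).s) L,                                         -- 3
   disjLines L K (V L o k t 1),                                                                                     -- 4
   ModMulU.Shift.dorLines (V L o k t 1) K L,                                                                        -- 5
   mkOrLines L o K k t,                                                                                             -- 6
   (List.range L).map (fun j => ctx K (eqv (Mul.msk L (Mk1 L o k) t j) ((V L o k t 1).s j))),                      -- 7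
   Adder.leibLines (Mul.ADD L (Mk1 L o k) t) (V L o k t 4) K L,                                                     -- 8
   MFI.lines L (F L o k t) K,                                                                                       -- 9
   ModAddU.MFI.transLines K (Mul.Rw L (Mk1 L o k) (t + 1)) ((V L o k t 5).s) L,                                   -- 10
   Adder.leibLines (V L o k t 2) (Mul.ADD L (Mk L o k) t) K L,                                                      -- 11
   disjLines L K (V L o k t 3),                                                                                     -- 12
   ModMulU.Shift.dorLines (V L o k t 3) K L,                                                                        -- 13
   qwOrLines L o K k t,                                                                                             -- 14
   (List.range L).map (fun j => ctx K (eqv (Qw L o k (t + 1) j) ((V L o k t 3).s j))),                              -- 15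
   ModAddU.MFI.symmLines K (Qw L o k (t + 1)) ((V L o k t 3).s) L,                                                 -- 16
   Adder.leibLines (V L o k t 5) (U L o k (t + 1)) K L,                                                            -- 17
   ModAddU.MFI.transLines K (Mul.Rw L (Mk1 L o k) (t + 1)) ((U L o k (t + 1)).s) L]                                -- 18

end Segs

/-- The length of the segment list. [folklore] -/
theorem length_segs (L : ℕ) (o : Occ) (K : PropForm ℕ) (k t : ℕ) : (segs L o K k t).length = 19 := rfl

variable {o : Occ}

/-- The operand words of the adders of `F_{k,t}`. [folklore] -/
theorem V_words {k t : ℕ} (hk : k < L) (ht : t < L) {i : ℕ} (hi : i < L) :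
    (V L o k t 0).x i = Mul.Rw L (Mk L o k) t i ∧ (V L o k t 0).y i = Qw L o k t i ∧ (V L o k t 1).x i = Mul.msk L (Mk L o k) t i ∧
    (V L o k t 1).y i = dw L o k t i ∧ (V L o k t 2).x i = Mul.Rw L (Mk L o k) t i ∧ (V L o k t 2).y i = Mul.msk L (Mk L o k) t i ∧
    (V L o k t 3).x i = Qw L o k t i ∧ (V L o k t 3).y i = dw L o k t i ∧
    (V L o k t 4).x i = (V L o k t 0).s i ∧ (V L o k t 4).y i = (V L o k t 1).s i ∧ (V L o k t 5).x i = (V L o k t 2).s i ∧ (V L o k t 5).y i = (V L o k t 3).s i := by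
  obtain ⟨f1, f2, f3, f4⟩ := FQ_inp (L := L) (o := o) hk ht hi
  have g1 : (FQ L o k t).inp (0 * L + i) = Mul.Rw L (MQ L o k) t i := by rw [Nat.zero_mul, Nat.zero_add]; exact f1
  have g2 : (FQ L o k t).inp (1 * L + i) = Qw L o k t i := by rw [Nat.one_mul]; exact f2
  refine ⟨g1, g2, f3, f4, g1, f3, g2, f4, ?_, ?_, ?_, ?_⟩ <;> exact (MFI.s_V (W := L) (o := F L o k t) _ i).symm

/-- The one-hot word. [folklore] -/
theorem dw_eq {k t j : ℕ} : (j = k + t → dw L o k t j = g L o k j) ∧ (j ≠ k + t → dw L o k t j = zz L o) :=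
  ⟨fun h => by unfold dw; rw [if_pos h], fun h => by unfold dw; rw [if_neg h]; rfl⟩

/-- `Qw_{k,t+1}` versus `Qw_{k,t}`. [folklore] -/
theorem Qw_cases {k t j : ℕ} :
    (k ≤ j → j < k + t → Qw L o k (t + 1) j = g L o k j ∧ Qw L o k t j = g L o k j) ∧ (j = k + t → Qw L o k (t + 1) j = g L o k j ∧ Qw L o k t j = zz L o) ∧
    (j < k ∨ k + t < j → Qw L o k (t + 1) j = zz L o ∧ Qw L o k t j = zz L o) := by
  refine ⟨fun h1 h2 => ?_, fun h => ?_, fun h => ?_⟩ <;> unfold Qw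
  · rw [if_pos ⟨h1, by omega⟩, if_pos ⟨h1, h2⟩]; exact ⟨rfl, rfl⟩
  · rw [if_pos ⟨by omega, by omega⟩, if_neg (by omega)]; exact ⟨rfl, rfl⟩
  · rw [if_neg (by omega), if_neg (by omega)]; exact ⟨rfl, rfl⟩

/-- The shifted operand words of `M_{k+1}` and `M_k` agree off the diagonal `j = k + t`. [folklore] -/
theorem ash_agree {k t j : ℕ} (hk : k + 1 ≤ L) (hj : j < L) (hne : j ≠ k + t) : Mul.ash L (MQ L o (k + 1)) t j = Mul.ash L (MQ L o k) t j := by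
  rw [ash_MQ hk hj, ash_MQ (by omega) hj]
  by_cases h : t ≤ j ∧ j - t < k
  · rw [if_pos ⟨h.1, by omega⟩, if_pos h]
  · rw [if_neg (by omega), if_neg h]

/-- **The stage forms a block.** [cite: CookReckhow1979, §2] -/
theorem isBlock_segs (hGC : ∀ r ∈ rules, r ∈ G.rules) (hGP : ∀ r ∈ Plain.rules, r ∈ G.rules) (hGH : ∀ r ∈ HZ.rules, r ∈ G.rules)
    (hGY : ∀ r ∈ ModMulU.Sys.sysRules, r ∈ G.rules) (hGN : ∀ r ∈ Netlist.rules, r ∈ G.rules) (hGA : ∀ r ∈ Adder.rules, r ∈ G.rules)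
    (hGL : ∀ r ∈ Logic.rules, r ∈ G.rules) (h : KAvail L o K Γ) {k t : ℕ} (hk : k + 1 ≤ L) (ht : t < L)
    (hzz : ctx K (neg (var (zz L o))) ∈ Γ) (hIH : ∀ i < L, ctx K (eqv (Mul.Rw L (Mk1 L o k) t i) ((U L o k t).s i)) ∈ Γ) :
    G.IsBlock Γ (segs L o K k t).flatten := by
  have hkL : k < L := by omega
  have aM : Mul.PAvail L (Mk L o k) K Γ := Mul.avail_ofOcc (h.hM k hkL.le)
  have aM1 : Mul.PAvail L (Mk1 L o k) K Γ := Mul.avail_ofOcc (h.hM (k + 1) hk)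
  have aF : MFI.MAvail L (F L o k t) K Γ := MFI.avail_ofOcc (h.hF k hkL t ht)
  have VW := fun i (hi : i < L) => V_words (L := L) (o := o) hkL ht hi
  refine ModAddU.AssocData.isBlock_flatten _ fun n hn => ?_
  rw [length_segs] at hn
  have mem : ∀ {χ} (j : ℕ) (hj : j < n) (hχ : χ ∈ (segs L o K k t)[j]'(by rw [length_segs]; omega)),
      χ ∈ Γ ∪ {χ | ∃ j, ∃ hj : j < n, χ ∈ (segs L o K k t)[j]'(by rw [length_segs]; omega)} := fun j hj hχ => Or.inr ⟨j, hj, hχ⟩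
  have hΓ : Γ ⊆ Γ ∪ {χ | ∃ j, ∃ hj : j < n, χ ∈ (segs L o K k t)[j]'(by rw [length_segs]; omega)} := fun _ hχ => Or.inl hχ
  have mr : ∀ {f : ℕ → PropForm ℕ} {i : ℕ}, i < L → f i ∈ (List.range L).map f := fun hi => List.mem_map.2 ⟨_, List.mem_range.2 hi, rfl⟩
  have hz := fun (hn0 : 0 < n) => (hΓ hzz : ctx K (neg (var (zz L o))) ∈ _)
  -- reflexivity of the words
  have rf : 0 < n → ∀ (w : ℕ) (z : ℕ → ℕ), (w = 0 ∧ z = Mul.Rw L (Mk L o k) t ∨ w = 1 ∧ z = Qw L o k t ∨ w = 2 ∧ z = Mul.msk L (Mk L o k) t ∨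
      w = 3 ∧ z = o.inp ∨ w = 4 ∧ z = fun j => o.inp (L + j)) → ∀ i < L,
      ctx K (eqv (z i) (z i)) ∈ Γ ∪ {χ | ∃ j, ∃ hj : j < n, χ ∈ (segs L o K k t)[j]'(by rw [length_segs]; omega)} := by
    intro hn0 w z hz i hi
    refine mem 0 hn0 (Adder.mem_reflLines ?_)
    simp only [List.mem_append, List.mem_map, List.mem_range, List.mem_singleton]
    rcases hz with ⟨-, rfl⟩ | ⟨-, rfl⟩ | ⟨-, rfl⟩ | ⟨-, rfl⟩ | ⟨-, rfl⟩
    · exact Or.inl (Or.inl (Or.inl (Or.inl (Or.inl ⟨i, hi, rfl⟩))))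
    · exact Or.inl (Or.inl (Or.inl (Or.inl (Or.inr ⟨i, hi, rfl⟩))))
    · exact Or.inl (Or.inl (Or.inl (Or.inr ⟨i, hi, rfl⟩)))
    · exact Or.inl (Or.inl (Or.inr ⟨i, hi, rfl⟩))
    · exact Or.inl (Or.inr ⟨i, hi, rfl⟩)
  -- adder congruence conclusions on the sum bits
  have mL : ∀ {P Q : Adder.View} (j : ℕ) (hj : j < n) (e : (segs L o K k t)[j]'(by rw [length_segs]; omega) = Adder.leibLines P Q K L) {i : ℕ} (hi : i < L),
      ctx K (eqv (P.s i) (Q.s i)) ∈ Γ ∪ {χ | ∃ j, ∃ hj : j < n, χ ∈ (segs L o K k t)[j]'(by rw [length_segs]; omega)} := by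
    intro P Q j hj e i hi; exact mem j hj (by rw [e]; exact Adder.mem_leibLines (k := 2 * i + 1) (by omega))
  interval_cases n
  · exact Adder.isBlock_reflLines hGA _ _ _
  · -- 1: the diagonal mask of `M_k` is false
    by_cases hkt : k + t < L
    · rw [show (segs L o K k t)[1] = [ctx K (neg (var (Mul.msk L (Mk L o k) t (k + t))))] from if_pos hkt]
      have hd := aM.1 t ht (k + t) hkt
      rw [Mul.mDef, show Mul.ash L (Mk L o k) t (k + t) = zz L o from by
        unfold Mk; rw [ash_MQ hkL.le hkt, if_neg (by omega)]] at hd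
      exact FregeSystem.IsBlock.singleton (Or.inr (HZ.infer hGH 0 (by decide) (FregeSystem.sub [K, var (Mul.msk L (Mk L o k) t (k + t)), var (Mul.bin L (Mk L o k) t), var (zz L o)]) rfl
        (FregeSystem.prems_cons (hΓ hd) (FregeSystem.prems_cons (hz (by omega)) FregeSystem.prems_nil))))
    · rw [show (segs L o K k t)[1] = [] from if_neg hkt]; exact FregeSystem.IsBlock.nil _ _
  · -- 2: `U_t ≡ AB`
    refine Adder.isBlock_leibLines hGN _ _ ((h.hU k hkL t ht.le).mono hΓ) ((aF 0 (by omega)).mono hΓ) (fun i hi => ?_) (fun i hi => ?_)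
    · rw [(VW i hi).1]; exact rf (by omega) 0 (Mul.Rw L (Mk L o k) t) (by simp) i hi
    · rw [(VW i hi).2.1]; exact rf (by omega) 1 (Qw L o k t) (by simp) i hi
  · -- 3: `R_t(M_{k+1}) ≡ AB.s`
    exact ModAddU.MFI.isBlock_transLines hGL K (fun i hi => hΓ (hIH i hi)) fun i hi => mL 2 (by omega) rfl hi
  · -- 4: disjointness for `CD`
    refine Scaffold.isBlock_of_forall fun θ hθ => ?_
    obtain ⟨j, hj, rfl⟩ := List.mem_map.1 hθ
    rw [List.mem_range] at hj
    rw [(VW j hj).2.2.1, show (V L o k t 1).y j = dw L o k t j from (VW j hj).2.2.2.1]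
    by_cases hjd : j = k + t
    · rw [dw_eq.1 hjd]
      have : ctx K (neg (var (Mul.msk L (Mk L o k) t j))) ∈ Γ ∪ {χ | ∃ j, ∃ hj : j < 4, χ ∈ (segs L o K k t)[j]'(by rw [length_segs]; omega)} := by
        subst hjd
        exact mem 1 (by omega) (by rw [show (segs L o K k t)[1] = [ctx K (neg (var (Mul.msk L (Mk L o k) t (k + t))))] from if_pos hj]; exact List.mem_singleton_self _)
      exact Or.inr (infer hGC 5 (by decide) (FregeSystem.sub [K, var (Mul.msk L (Mk L o k) t j), var (g L o k j)]) rfl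
        (FregeSystem.prems_cons this FregeSystem.prems_nil))
    · rw [dw_eq.2 hjd]
      exact Or.inr (infer hGC 6 (by decide) (FregeSystem.sub [K, var (Mul.msk L (Mk L o k) t j), var (zz L o)]) rfl
        (FregeSystem.prems_cons (hz (by omega)) FregeSystem.prems_nil))
  · -- 5: the disjoint sum `CD`
    exact ModMulU.Shift.isBlock_dorLines hGY ((aF 1 (by omega)).mono hΓ) fun i hi => mem 4 (by omega) (mr hi)
  · -- 6: `m₁ⱼ ↔ (mⱼ ∨ δⱼ)`
    refine Scaffold.isBlock_of_forall fun θ hθ => ?_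
    obtain ⟨j, hj, rfl⟩ := List.mem_map.1 hθ
    rw [List.mem_range] at hj
    rw [(VW j hj).2.2.1, show (V L o k t 1).y j = dw L o k t j from (VW j hj).2.2.2.1]
    have d1 := aM1.1 t ht j hj
    have d0 := aM.1 t ht j hj
    rw [Mul.mDef, show Mul.bin L (Mk1 L o k) t = o.inp (L + t) from bin_MQ hk ht] at d1
    rw [Mul.mDef, show Mul.bin L (Mk L o k) t = o.inp (L + t) from bin_MQ hkL.le ht] at d0
    by_cases hjd : j = k + t
    · rw [dw_eq.1 hjd]
      rw [show Mul.ash L (Mk1 L o k) t j = o.inp k from by unfold Mk1; rw [ash_MQ hk hj, if_pos ⟨by omega, by omega⟩]; congr 1; omega] at d1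
      rw [show Mul.ash L (Mk L o k) t j = zz L o from by unfold Mk; rw [ash_MQ hkL.le hj, if_neg (by omega)]] at d0
      have dq := h.hQ k hkL j hj
      rw [qDef, show bsh L o k j = o.inp (L + t) from by unfold bsh; rw [if_pos (by omega)]; congr 1; omega] at dq
      exact Or.inr (infer hGC 3 (by decide) (FregeSystem.sub [K, var (Mul.msk L (Mk1 L o k) t j), var (Mul.msk L (Mk L o k) t j), var (g L o k j), var (zz L o),
        var (o.inp (L + t)), var (o.inp k)]) rfl
        (FregeSystem.prems_cons (hΓ d1) (FregeSystem.prems_cons (hΓ d0) (FregeSystem.prems_cons (hz (by omega)) (FregeSystem.prems_cons (hΓ dq) FregeSystem.prems_nil)))))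
    · rw [dw_eq.2 hjd]
      rw [show Mul.ash L (Mk1 L o k) t j = Mul.ash L (Mk L o k) t j from ash_agree hk hj hjd] at d1
      exact Or.inr (infer hGC 7 (by decide) (FregeSystem.sub [K, var (Mul.msk L (Mk1 L o k) t j), var (Mul.msk L (Mk L o k) t j), var (o.inp (L + t)),
        var (Mul.ash L (Mk L o k) t j), var (zz L o)]) rfl
        (FregeSystem.prems_cons (hΓ d1) (FregeSystem.prems_cons (hΓ d0) (FregeSystem.prems_cons (hz (by omega)) FregeSystem.prems_nil))))
  · -- 7: `m₁ⱼ ≡ CD.sⱼ`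
    refine Scaffold.isBlock_of_forall fun θ hθ => ?_
    obtain ⟨j, hj, rfl⟩ := List.mem_map.1 hθ
    rw [List.mem_range] at hj
    exact Or.inr (infer hGC 4 (by decide) (FregeSystem.sub [K, var ((V L o k t 1).s j), var (Mul.msk L (Mk1 L o k) t j), var ((V L o k t 1).x j), var ((V L o k t 1).y j)]) rfl
      (FregeSystem.prems_cons (mem 5 (by omega) (ModMulU.Shift.mem_dorLines hj)) (FregeSystem.prems_cons (mem 6 (by omega) (mr hj)) FregeSystem.prems_nil)))
  · -- 8: `R_{t+1}(M_{k+1}) ≡ S1`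
    refine Adder.isBlock_leibLines hGN _ _ ((aM1.2 t ht).mono hΓ) ((aF 4 (by omega)).mono hΓ) (fun i hi => ?_) (fun i hi => ?_)
    · rw [(VW i hi).2.2.2.2.2.2.2.2.1]; exact mem 3 (by omega) (mr hi)
    · rw [(VW i hi).2.2.2.2.2.2.2.2.2.1]; exact mem 7 (by omega) (mr hi)
  · -- 9: the interchange
    exact MFI.isBlock_lines hGP hGN hGA hGL fun m hm => (aF m hm).mono hΓ
  · -- 10: `R_{t+1}(M_{k+1}) ≡ S2.s`
    refine ModAddU.MFI.isBlock_transLines hGL K (fun i hi => ?_) fun i hi => mem 9 (by omega) (MFI.mem_lines hi)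
    have := mL 8 (by omega) rfl hi
    rw [Mul.s_ADD] at this; exact this
  · -- 11: `AC ≡ R_{t+1}(M_k)`
    refine Adder.isBlock_leibLines hGN _ _ ((aF 2 (by omega)).mono hΓ) ((aM.2 t ht).mono hΓ) (fun i hi => ?_) (fun i hi => ?_)
    · rw [(VW i hi).2.2.2.2.1]; exact rf (by omega) 0 (Mul.Rw L (Mk L o k) t) (by simp) i hi
    · rw [(VW i hi).2.2.2.2.2.1]; exact rf (by omega) 2 (Mul.msk L (Mk L o k) t) (by simp) i hi
  · -- 12: disjointness for `BD`
    refine Scaffold.isBlock_of_forall fun θ hθ => ?_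
    obtain ⟨j, hj, rfl⟩ := List.mem_map.1 hθ
    rw [List.mem_range] at hj
    rw [(VW j hj).2.2.2.2.2.2.1, show (V L o k t 3).y j = dw L o k t j from (VW j hj).2.2.2.2.2.2.2.1]
    by_cases hjd : j = k + t
    · rw [(Qw_cases.2.1 hjd).2]
      exact Or.inr (infer hGC 5 (by decide) (FregeSystem.sub [K, var (zz L o), var (dw L o k t j)]) rfl (FregeSystem.prems_cons (hz (by omega)) FregeSystem.prems_nil))
    · rw [dw_eq.2 hjd]
      exact Or.inr (infer hGC 6 (by decide) (FregeSystem.sub [K, var (Qw L o k t j), var (zz L o)]) rfl (FregeSystem.prems_cons (hz (by omega)) FregeSystem.prems_nil))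
  · -- 13: the disjoint sum `BD`
    exact ModMulU.Shift.isBlock_dorLines hGY ((aF 3 (by omega)).mono hΓ) fun i hi => mem 12 (by omega) (mr hi)
  · -- 14: `Qw_{t+1,j} ↔ (Qw_{t,j} ∨ δⱼ)`
    refine Scaffold.isBlock_of_forall fun θ hθ => ?_
    obtain ⟨j, hj, rfl⟩ := List.mem_map.1 hθ
    rw [List.mem_range] at hj
    rw [(VW j hj).2.2.2.2.2.2.1, show (V L o k t 3).y j = dw L o k t j from (VW j hj).2.2.2.2.2.2.2.1]
    by_cases hjd : j = k + t
    · obtain ⟨e1, e2⟩ := Qw_cases.2.1 hjd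
      rw [e1, e2, dw_eq.1 hjd]
      exact Or.inr (infer hGC 2 (by decide) (FregeSystem.sub [K, var (g L o k j), var (zz L o)]) rfl (FregeSystem.prems_cons (hz (by omega)) FregeSystem.prems_nil))
    · rw [dw_eq.2 hjd]
      by_cases hr : k ≤ j ∧ j < k + t
      · obtain ⟨e1, e2⟩ := Qw_cases.1 hr.1 hr.2
        rw [e1, e2]
        exact Or.inr (infer hGC 1 (by decide) (FregeSystem.sub [K, var (g L o k j), var (zz L o)]) rfl (FregeSystem.prems_cons (hz (by omega)) FregeSystem.prems_nil))
      · obtain ⟨e1, e2⟩ := Qw_cases.2.2 (show j < k ∨ k + t < j by omega)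
        rw [e1, e2]
        exact Or.inr (infer hGC 1 (by decide) (FregeSystem.sub [K, var (zz L o), var (zz L o)]) rfl (FregeSystem.prems_cons (hz (by omega)) FregeSystem.prems_nil))
  · -- 15: `Qw_{t+1,j} ≡ BD.sⱼ`
    refine Scaffold.isBlock_of_forall fun θ hθ => ?_
    obtain ⟨j, hj, rfl⟩ := List.mem_map.1 hθ
    rw [List.mem_range] at hj
    exact Or.inr (infer hGC 4 (by decide) (FregeSystem.sub [K, var ((V L o k t 3).s j), var (Qw L o k (t + 1) j), var ((V L o k t 3).x j), var ((V L o k t 3).y j)]) rfl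
      (FregeSystem.prems_cons (mem 13 (by omega) (ModMulU.Shift.mem_dorLines hj)) (FregeSystem.prems_cons (mem 14 (by omega) (mr hj)) FregeSystem.prems_nil)))
  · -- 16
    exact ModAddU.MFI.isBlock_symmLines hGL K fun i hi => mem 15 (by omega) (mr hi)
  · -- 17: `S2 ≡ U_{t+1}`
    refine Adder.isBlock_leibLines hGN _ _ ((aF 5 (by omega)).mono hΓ) ((h.hU k hkL (t + 1) (by omega)).mono hΓ) (fun i hi => ?_) (fun i hi => ?_)
    · rw [(VW i hi).2.2.2.2.2.2.2.2.2.2.1, show (U L o k (t + 1)).x i = (Mul.ADD L (Mk L o k) t).s i from (Mul.s_ADD (o := Mk L o k) t i).symm]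
      exact mL 11 (by omega) rfl hi
    · rw [(VW i hi).2.2.2.2.2.2.2.2.2.2.2]; exact mem 16 (by omega) (mr hi)
  · -- 18: the new induction hypothesis
    exact ModAddU.MFI.isBlock_transLines hGL K (fun i hi => mem 10 (by omega) (mr hi)) fun i hi => mL 17 (by omega) rfl hi

/-- **The conclusion of the stage**: `R_{t+1}(M_{k+1}) ≡ U_{k,t+1}`. [folklore] -/
theorem mem_segs {k t i : ℕ} (hi : i < L) :
    ctx K (eqv (Mul.Rw L (Mk1 L o k) (t + 1) i) ((U L o k (t + 1)).s i)) ∈ (segs L o K k t).flatten := by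
  have h19 : (segs L o K k t).length = 19 := rfl
  exact List.mem_flatten.2 ⟨_, List.getElem_mem (n := 18) (by omega), List.mem_map.2 ⟨i, List.mem_range.2 hi, rfl⟩⟩

/-! ### Linearity: the recursion over `t` -/

section LinDefs

variable (L : ℕ) (o : Occ) (K : PropForm ℕ) (k : ℕ)

/-- The base `t = 0`: `U_{k,0} = 0 + 0` has false sums, so `R_0(M_{k+1}) = 0 ≡ U_{k,0}`. [folklore] -/
def linBase : List (PropForm ℕ) :=
  (zaddLines (U L o k 0) K L ++ zaddSplit (U L o k 0) K L) ++ ModAddU.MFI.symmLines K ((U L o k 0).s) (fun _ => zz L o) L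

/-- The lines up to stage `t`. [folklore] -/
def linUpTo : ℕ → List (PropForm ℕ)
  | 0 => linBase L o K k
  | t + 1 => linUpTo t ++ (segs L o K k t).flatten

/-- **The linearity lines**: `R_L(M_{k+1}) ≡ U_{k,L}`. [folklore] -/
def linLines : List (PropForm ℕ) := linUpTo L o K k L

end LinDefs

/-- The induction hypothesis after `t` stages. [folklore] -/
theorem mem_linUpTo {k : ℕ} (hk : k + 1 ≤ L) : ∀ {t i : ℕ}, i < L → ctx K (eqv (Mul.Rw L (Mk1 L o k) t i) ((U L o k t).s i)) ∈ linUpTo L o K k t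
  | 0, i, hi => by
    rw [show Mul.Rw L (Mk1 L o k) 0 i = zz L o from Rw_zero hk i]
    exact List.mem_append_right _ (List.mem_map.2 ⟨i, List.mem_range.2 hi, rfl⟩)
  | t + 1, i, hi => List.mem_append_right _ (mem_segs hi)

/-- **The linearity recursion forms a block.** [cite: CookReckhow1979, §2] -/
theorem isBlock_linUpTo (hGC : ∀ r ∈ rules, r ∈ G.rules) (hGP : ∀ r ∈ Plain.rules, r ∈ G.rules) (hGH : ∀ r ∈ HZ.rules, r ∈ G.rules)
    (hGX : ∀ r ∈ splitRules, r ∈ G.rules) (hGY : ∀ r ∈ ModMulU.Sys.sysRules, r ∈ G.rules) (hGN : ∀ r ∈ Netlist.rules, r ∈ G.rules)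
    (hGA : ∀ r ∈ Adder.rules, r ∈ G.rules) (hGL : ∀ r ∈ Logic.rules, r ∈ G.rules) (h : KAvail L o K Γ) {k : ℕ} (hk : k + 1 ≤ L)
    (hzz : ctx K (neg (var (zz L o))) ∈ Γ) : ∀ t ≤ L, G.IsBlock Γ (linUpTo L o K k t) := by
  intro t ht
  induction t with
  | zero =>
    refine (isBlock_zaddSplit hGP hGX (h.hU k (by omega) 0 (Nat.zero_le _)) fun i hi => ?_).append (ModAddU.MFI.isBlock_symmLines hGL K fun i hi => ?_)
    · rw [show (U L o k 0).y i = zz L o from by show Qw L o k 0 i = _; unfold Qw; rw [if_neg (by omega)]; rfl]; exact hzz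
    · have := (mem_zaddSplit (K := K) (S := U L o k 0) (W := L) (i := i) hi).1
      rw [show (U L o k 0).x i = zz L o from Rw_zero (by omega) i] at this
      exact Or.inr this
  | succ t ih =>
    refine (ih (by omega)).append (isBlock_segs hGC hGP hGH hGY hGN hGA hGL ⟨fun k hk => (h.hM k hk).mono Set.subset_union_left, h.hMP.mono Set.subset_union_left,
      fun k hk j hj => Or.inl (h.hQ k hk j hj), fun k hk t ht => (h.hU k hk t ht).mono Set.subset_union_left, fun k hk t ht => (h.hF k hk t ht).mono Set.subset_union_left⟩
      hk (by omega) (Or.inl hzz) fun i hi => Or.inr (mem_linUpTo hk hi))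

/-! ### Commutativity: the induction over `k` -/

section CommDefs

variable (L : ℕ) (o : Occ) (K : PropForm ℕ)

/-- The lines `mask_k(M')ⱼ ≡ Qw_{k,L,j}`. [folklore] -/
def mqLines (k : ℕ) : List (PropForm ℕ) := (List.range L).map fun j => ctx K (eqv (Mul.msk L (MP L o) k j) (Qw L o k L j))

/-- The step `k → k + 1`: linearity for `k`, the mask identification, the congruence of the
adders `R_{k+1}(M') = R_k(M') + mask_k(M')` and `U_{k,L}`, symmetry and transitivity. [folklore] -/
def stepLines (k : ℕ) : List (PropForm ℕ) :=
  linLines L o K k ++ ((List.range k).map (fun j => ctx K (neg (var (Mul.msk L (MP L o) k j)))) ++ (mqLines L o K k ++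
    (Adder.leibLines (Mul.ADD L (MP L o) k) (U L o k L) K L ++
    (ModAddU.MFI.symmLines K (Mul.Rw L (Mk1 L o k) L) ((U L o k L).s) L ++
     ModAddU.MFI.transLines K (Mul.Rw L (MP L o) (k + 1)) (Mul.Rw L (MQ L o (k + 1)) L) L))))

/-- The base: `M_0 = M(0, b)` has a false output. [folklore] -/
def baseLines : List (PropForm ℕ) := HZ.mulLines L (MQ L o 0) K 0 0 ++ (List.range L).map fun i => ctx K (eqv (Mul.Rw L (MP L o) 0 i) (Mul.Rw L (MQ L o 0) L i))

/-- The lines up to `k`. [folklore] -/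
def commUpTo : ℕ → List (PropForm ℕ)
  | 0 => baseLines L o K
  | k + 1 => commUpTo k ++ stepLines L o K k

/-- **The lines of the commutativity law.** [folklore] -/
def lines : List (PropForm ℕ) := commUpTo L o K L

end CommDefs

/-- The mask identification lines. [folklore] -/
theorem mem_mqLines {k i : ℕ} (hi : i < L) : ctx K (eqv (Mul.msk L (MP L o) k i) (Qw L o k L i)) ∈ mqLines L o K k :=
  List.mem_map.2 ⟨i, List.mem_range.2 hi, rfl⟩

/-- The induction hypothesis after `k` steps: `R_k(M') ≡ R_L(M_k)`. [folklore] -/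
theorem mem_commUpTo : ∀ {k i : ℕ}, i < L → ctx K (eqv (Mul.Rw L (MP L o) k i) (Mul.Rw L (MQ L o k) L i)) ∈ commUpTo L o K k
  | 0, i, hi => List.mem_append_right _ (List.mem_map.2 ⟨i, List.mem_range.2 hi, rfl⟩)
  | _ + 1, i, hi => List.mem_append_right _ (List.mem_append_right _ (List.mem_append_right _ (List.mem_append_right _
      (List.mem_append_right _ (List.mem_append_right _ (List.mem_map.2 ⟨i, List.mem_range.2 hi, rfl⟩))))))

/-- **The step forms a block.** [cite: CookReckhow1979, §2] -/
theorem isBlock_stepLines (hGC : ∀ r ∈ rules, r ∈ G.rules) (hGP : ∀ r ∈ Plain.rules, r ∈ G.rules) (hGH : ∀ r ∈ HZ.rules, r ∈ G.rules)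
    (hGX : ∀ r ∈ splitRules, r ∈ G.rules) (hGY : ∀ r ∈ ModMulU.Sys.sysRules, r ∈ G.rules) (hGN : ∀ r ∈ Netlist.rules, r ∈ G.rules)
    (hGA : ∀ r ∈ Adder.rules, r ∈ G.rules) (hGL : ∀ r ∈ Logic.rules, r ∈ G.rules) (h : KAvail L o K Γ) {k : ℕ} (hk : k + 1 ≤ L)
    (hzz : ctx K (neg (var (zz L o))) ∈ Γ) (hJ : ∀ i < L, ctx K (eqv (Mul.Rw L (MP L o) k i) (Mul.Rw L (MQ L o k) L i)) ∈ Γ) :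
    G.IsBlock Γ (stepLines L o K k) := by
  have hkL : k < L := by omega
  have aP : Mul.PAvail L (MP L o) K Γ := Mul.avail_ofOcc h.hMP
  obtain ⟨-, p1, p2, p3⟩ := MP_facts (L := L) (o := o)
  have s1 : ∀ {A B : Set (PropForm ℕ)}, A ⊆ A ∪ B := fun {_ _} => Set.subset_union_left
  have hbin : Mul.bin L (MP L o) k = o.inp k := p2 k hkL
  have hashP : ∀ j < L, Mul.ash L (MP L o) k j = if k ≤ j then o.inp (L + (j - k)) else zz L o := fun j hj => by
    unfold Mul.ash; split_ifs with hkj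
    · exact p1 _ (by omega)
    · exact p3
  refine (isBlock_linUpTo hGC hGP hGH hGX hGY hGN hGA hGL h hk hzz L le_rfl).append ?_
  -- the low masks of `M'` are false
  refine (Scaffold.isBlock_of_forall fun θ hθ => ?_).append ?_
  · obtain ⟨j, hj, rfl⟩ := List.mem_map.1 hθ
    rw [List.mem_range] at hj
    have hd := aP.1 k hkL j (by omega)
    rw [Mul.mDef, hbin, hashP j (by omega), if_neg (by omega)] at hd
    exact Or.inr (HZ.infer hGH 0 (by decide) (FregeSystem.sub [K, var (Mul.msk L (MP L o) k j), var (o.inp k), var (zz L o)]) rfl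
      (FregeSystem.prems_cons (s1 hd) (FregeSystem.prems_cons (s1 hzz) FregeSystem.prems_nil)))
  -- the masks of `M'` are the words `Qw_{k,L}`
  refine (Scaffold.isBlock_of_forall fun θ hθ => ?_).append ?_
  · obtain ⟨j, hj, rfl⟩ := List.mem_map.1 hθ
    rw [List.mem_range] at hj
    by_cases hkj : k ≤ j
    · have hd := aP.1 k hkL j hj
      rw [Mul.mDef, hbin, hashP j hj, if_pos hkj] at hd
      have dq := h.hQ k hkL j hj
      rw [qDef, show bsh L o k j = o.inp (L + (j - k)) from by unfold bsh; rw [if_pos hkj]] at dq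
      rw [show Qw L o k L j = g L o k j from by unfold Qw; rw [if_pos ⟨hkj, by omega⟩]]
      exact Or.inr (infer hGC 8 (by decide) (FregeSystem.sub [K, var (Mul.msk L (MP L o) k j), var (g L o k j), var (o.inp k), var (o.inp (L + (j - k)))]) rfl
        (FregeSystem.prems_cons (s1 (s1 hd)) (FregeSystem.prems_cons (s1 (s1 dq)) FregeSystem.prems_nil)))
    · rw [show Qw L o k L j = zz L o from by unfold Qw; rw [if_neg (by omega)]; rfl]
      exact Or.inr (Logic.infer hGL 10 (by decide) (FregeSystem.sub [K, var (Mul.msk L (MP L o) k j), var (zz L o)]) rfl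
        (FregeSystem.prems_cons (Or.inr (List.mem_map.2 ⟨j, List.mem_range.2 (by omega), rfl⟩)) (FregeSystem.prems_cons (s1 (s1 hzz)) FregeSystem.prems_nil)))
  -- the adders `R_{k+1}(M')` and `U_{k,L}` are congruent; conclude
  refine (Adder.isBlock_leibLines hGN _ _ ((aP.2 k hkL).mono (s1.trans (s1.trans s1))) ((h.hU k hkL L le_rfl).mono (s1.trans (s1.trans s1)))
    (fun i hi => s1 (s1 (s1 (hJ i hi)))) (fun i hi => Or.inr (mem_mqLines hi))).append
    ((ModAddU.MFI.isBlock_symmLines hGL K fun i hi => Or.inl (Or.inl (Or.inl (Or.inr (mem_linUpTo hk hi))))).append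
    (ModAddU.MFI.isBlock_transLines hGL K (fun i hi => ?_) fun i hi => Or.inr (List.mem_map.2 ⟨i, List.mem_range.2 hi, rfl⟩)))
  have := Adder.mem_leibLines (P := Mul.ADD L (MP L o) k) (Q := U L o k L) (K := K) (W := L) (k := 2 * i + 1) (by omega)
  rw [show (Mul.ADD L (MP L o) k).wire (2 * i + 1) = Mul.Rw L (MP L o) (k + 1) i from Mul.s_ADD k i] at this
  exact Or.inl (Or.inr this)

/-- **The base forms a block**: `M_0 = M(0, b)` has a false output, so `R_0(M') = 0 ≡ R_L(M_0)`. [cite: CookReckhow1979, §2] -/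
theorem isBlock_baseLines (hGP : ∀ r ∈ Plain.rules, r ∈ G.rules) (hGH : ∀ r ∈ HZ.rules, r ∈ G.rules) (hGX : ∀ r ∈ splitRules, r ∈ G.rules)
    (hGL : ∀ r ∈ Logic.rules, r ∈ G.rules) (h : KAvail L o K Γ) (hzz : ctx K (neg (var (zz L o))) ∈ Γ) : G.IsBlock Γ (baseLines L o K) := by
  have hL0 : (0 : ℕ) ≤ L := Nat.zero_le _
  have aM : Mul.PAvail L (MQ L o 0) K Γ := Mul.avail_ofOcc (h.hM 0 hL0)
  obtain ⟨-, -, -, e3⟩ := MQ_facts (L := L) (o := o) hL0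
  have hz' : ctx K (neg (var ((MQ L o 0).inp (2 * L)))) ∈ Γ := by rw [e3]; exact hzz
  have hash : ∀ t < L, ∀ j < L, ctx K (neg (var (Mul.ash L (MQ L o 0) t j))) ∈ Γ := fun t _ j hj => by
    rw [ash_MQ hL0 hj, if_neg (by omega)]; exact hzz
  have ha : ∀ i, 0 ≤ i → i < L → ctx K (neg (var ((MQ L o 0).inp i))) ∈ Γ := fun i _ hi => by
    rw [(MQ_facts (L := L) (o := o) hL0).2.1 i hi, if_neg (by omega)]; exact hzz
  refine (HZ.isBlock_mulLines hGH hGP hGX hGL aM (by omega) ha (fun t _ ht => Or.inr (hash t ht)) hz').append ?_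
  refine Scaffold.isBlock_of_forall fun θ hθ => ?_
  obtain ⟨i, hi, rfl⟩ := List.mem_map.1 hθ
  rw [List.mem_range] at hi
  have hR := HZ.mem_mulLines_hz (G := G) hGH hGP hGX hGL aM (by omega) ha (fun t _ ht => Or.inr (hash t ht)) hz' hL0 i (by omega) hi
  rw [show Mul.Rw L (MP L o) 0 i = zz L o from by unfold Mul.Rw; rw [if_pos rfl]; exact (MP_facts (L := L) (o := o)).2.2.2]
  exact Or.inr (Logic.infer hGL 10 (by decide) (FregeSystem.sub [K, var (zz L o), var (Mul.Rw L (MQ L o 0) L i)]) rfl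
    (FregeSystem.prems_cons (Or.inl hzz) (FregeSystem.prems_cons hR FregeSystem.prems_nil)))

/-- **Commutativity of integer multiplication inside Frege**: for an available occurrence of the
commutativity kit with the zero gate false, `R_k(M') ≡ R_L(M_k)` for all `k ≤ L`; at `k = L`:
`M(b, a) ≡ M(a, b)` bitwise. [cite: CookReckhow1979, §2] -/
theorem isBlock_commUpTo (hGC : ∀ r ∈ rules, r ∈ G.rules) (hGP : ∀ r ∈ Plain.rules, r ∈ G.rules) (hGH : ∀ r ∈ HZ.rules, r ∈ G.rules)
    (hGX : ∀ r ∈ splitRules, r ∈ G.rules) (hGY : ∀ r ∈ ModMulU.Sys.sysRules, r ∈ G.rules) (hGN : ∀ r ∈ Netlist.rules, r ∈ G.rules)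
    (hGA : ∀ r ∈ Adder.rules, r ∈ G.rules) (hGL : ∀ r ∈ Logic.rules, r ∈ G.rules) (h : KAvail L o K Γ) (hzz : ctx K (neg (var (zz L o))) ∈ Γ) :
    ∀ k ≤ L, G.IsBlock Γ (commUpTo L o K k) := by
  intro k hk
  induction k with
  | zero => exact isBlock_baseLines hGP hGH hGX hGL h hzz
  | succ k ih =>
    exact (ih (by omega)).append (isBlock_stepLines hGC hGP hGH hGX hGY hGN hGA hGL ⟨fun k hk => (h.hM k hk).mono Set.subset_union_left,
      h.hMP.mono Set.subset_union_left, fun k hk j hj => Or.inl (h.hQ k hk j hj), fun k hk t ht => (h.hU k hk t ht).mono Set.subset_union_left,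
      fun k hk t ht => (h.hF k hk t ht).mono Set.subset_union_left⟩ hk (Or.inl hzz) fun i hi => Or.inr (mem_commUpTo hi))

/-- **The commutativity law.** [cite: CookReckhow1979, §2] -/
theorem isBlock_lines (hGC : ∀ r ∈ rules, r ∈ G.rules) (hGP : ∀ r ∈ Plain.rules, r ∈ G.rules) (hGH : ∀ r ∈ HZ.rules, r ∈ G.rules)
    (hGX : ∀ r ∈ splitRules, r ∈ G.rules) (hGY : ∀ r ∈ ModMulU.Sys.sysRules, r ∈ G.rules) (hGN : ∀ r ∈ Netlist.rules, r ∈ G.rules)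
    (hGA : ∀ r ∈ Adder.rules, r ∈ G.rules) (hGL : ∀ r ∈ Logic.rules, r ∈ G.rules) (h : KAvail L o K Γ) (hzz : ctx K (neg (var (zz L o))) ∈ Γ) :
    G.IsBlock Γ (lines L o K) :=
  isBlock_commUpTo hGC hGP hGH hGX hGY hGN hGA hGL h hzz L le_rfl

/-- **The conclusion**: `R_L(M')ᵢ ↔ R_L(M_L)ᵢ`, i.e. `M(b, a) ≡ M(a, b)` bitwise. [folklore] -/
theorem mem_lines {i : ℕ} (hi : i < L) : ctx K (eqv (Mul.Rw L (MP L o) L i) (Mul.Rw L (MQ L o L) L i)) ∈ lines L o K := mem_commUpTo hi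

/-! ### Size -/

/-- Size of a map of small lines. [folklore] -/
theorem proofSize_mapL {f : ℕ → PropForm ℕ} {n B : ℕ} (h : ∀ i < n, (f i).size ≤ B) : proofSize ((List.range n).map f) ≤ n * B :=
  proofSize_map_range_le h

/-- **Size of a stage**: `≤ 60 (L+1) (|K| + 130)`. [folklore] -/
theorem proofSize_segs (L : ℕ) (o : Occ) (K : PropForm ℕ) (k t : ℕ) : proofSize (segs L o K k t).flatten ≤ 60 * ((L + 1) * (K.size + 130)) := by
  have hK := Nat.zero_le K.size
  have hR : proofSize (Adder.reflLines K ((List.range L).map (Mul.Rw L (Mk L o k) t) ++ (List.range L).map (Qw L o k t) ++ (List.range L).map (Mul.msk L (Mk L o k) t) ++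
      (List.range L).map (o.inp) ++ (List.range L).map (fun j => o.inp (L + j)) ++ [zz L o])) ≤ 6 * ((L + 1) * (K.size + 130)) := by
    rw [Adder.proofSize_reflLines]; simp only [List.length_append, List.length_map, List.length_range, List.length_singleton]; nlinarith
  have h1 : proofSize (if k + t < L then [ctx K (neg (var (Mul.msk L (Mk L o k) t (k + t))))] else []) ≤ (L + 1) * (K.size + 130) := by
    split_ifs
    · simp [proofSize, ctx, size]; nlinarith
    · simp [proofSize]
  have hL : ∀ (P Q : Adder.View), proofSize (Adder.leibLines P Q K L) ≤ 2 * ((L + 1) * (K.size + 130)) := fun P Q => (Adder.proofSize_leibLines P Q K L).trans (by nlinarith)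
  have hT : ∀ (u w : ℕ → ℕ), proofSize ((List.range L).map fun i => ctx K (eqv (u i) (w i))) ≤ (L + 1) * (K.size + 130) :=
    fun u w => (proofSize_mapL (B := K.size + 10) fun i _ => by simp [ctx, eqv, size, FregeSystem.size_biimp]).trans (by nlinarith)
  have hD : ∀ (S : Adder.View), proofSize (disjLines L K S) ≤ (L + 1) * (K.size + 130) :=
    fun S => (proofSize_mapL (B := K.size + 6) fun i _ => by simp [ctx, size]).trans (by nlinarith)
  have hO : ∀ (S : Adder.View), proofSize (ModMulU.Shift.dorLines S K L) ≤ 3 * ((L + 1) * (K.size + 130)) :=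
    fun S => (ModMulU.Shift.proofSize_dorLines S K L).trans (by nlinarith)
  have hMk : proofSize (mkOrLines L o K k t) ≤ (L + 1) * (K.size + 130) :=
    (proofSize_mapL (B := K.size + 14) fun i _ => by simp [ctx, size, FregeSystem.size_biimp]).trans (by nlinarith)
  have hQw : proofSize (qwOrLines L o K k t) ≤ (L + 1) * (K.size + 130) :=
    (proofSize_mapL (B := K.size + 14) fun i _ => by simp [ctx, size, FregeSystem.size_biimp]).trans (by nlinarith)
  have hF : proofSize (MFI.lines L (F L o k t) K) ≤ 24 * ((L + 1) * (K.size + 130)) := MFI.proofSize_lines L _ K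
  simp only [segs, List.flatten_cons, List.flatten_nil, proofSize_append, List.append_nil]
  have t3 := hT (Mul.Rw L (Mk1 L o k) t) ((V L o k t 0).s)
  have t7 := hT (Mul.msk L (Mk1 L o k) t) ((V L o k t 1).s)
  have t10 := hT (Mul.Rw L (Mk1 L o k) (t + 1)) ((V L o k t 5).s)
  have t15 := hT (Qw L o k (t + 1)) ((V L o k t 3).s)
  have t16 := hT ((V L o k t 3).s) (Qw L o k (t + 1))
  have t18 := hT (Mul.Rw L (Mk1 L o k) (t + 1)) ((U L o k (t + 1)).s)
  unfold ModAddU.MFI.transLines ModAddU.MFI.symmLines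
  linarith [hR, h1, hL (U L o k t) (V L o k t 0), hD (V L o k t 1), hO (V L o k t 1), hMk, hL (Mul.ADD L (Mk1 L o k) t) (V L o k t 4), hF,
    hL (V L o k t 2) (Mul.ADD L (Mk L o k) t), hD (V L o k t 3), hO (V L o k t 3), hQw, hL (V L o k t 5) (U L o k (t + 1))]

/-- Size of the linearity lines: `≤ 61 (L+1)² (|K| + 130)`. [folklore] -/
theorem proofSize_linLines (L : ℕ) (o : Occ) (K : PropForm ℕ) (k : ℕ) : proofSize (linLines L o K k) ≤ 61 * ((L + 1) * (L + 1)) * (K.size + 130) := by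
  have hK := Nat.zero_le K.size
  have hb : proofSize (linBase L o K k) ≤ (5 * L + 1) * (K.size + 20) := by
    unfold linBase; rw [proofSize_append]
    have h1 := proofSize_zaddSplit (U L o k 0) K L
    have h2 : proofSize (ModAddU.MFI.symmLines K ((U L o k 0).s) (fun _ => zz L o) L) ≤ L * (K.size + 10) := by
      unfold ModAddU.MFI.symmLines; exact proofSize_mapL (B := K.size + 10) fun i _ => by simp [ctx, eqv, size, FregeSystem.size_biimp]
    nlinarith
  have h : ∀ t, proofSize (linUpTo L o K k t) ≤ (5 * L + 1) * (K.size + 20) + t * (60 * ((L + 1) * (K.size + 130))) := by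
    intro t
    induction t with
    | zero => simpa [linUpTo] using hb
    | succ t ih => rw [linUpTo, proofSize_append]; nlinarith [proofSize_segs L o K k t]
  exact (h L).trans (by nlinarith)

/-- Size of the step: `≤ 66 (L+1)² (|K| + 130)`. [folklore] -/
theorem proofSize_stepLines (L : ℕ) (o : Occ) (K : PropForm ℕ) (k : ℕ) (hk : k ≤ L) : proofSize (stepLines L o K k) ≤ 66 * ((L + 1) * (L + 1)) * (K.size + 130) := by
  have hK := Nat.zero_le K.size
  have h1 := proofSize_linLines L o K k
  have h2 : proofSize ((List.range k).map fun j => ctx K (neg (var (Mul.msk L (MP L o) k j)))) ≤ L * (K.size + 4) :=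
    (proofSize_mapL (B := K.size + 4) fun i _ => by simp [ctx, size]).trans (Nat.mul_le_mul_right _ hk)
  have h3 : proofSize (mqLines L o K k) ≤ L * (K.size + 10) := proofSize_mapL (B := K.size + 10) fun i _ => by simp [ctx, eqv, size, FregeSystem.size_biimp]
  have h4 := Adder.proofSize_leibLines (Mul.ADD L (MP L o) k) (U L o k L) K L
  have h5 : proofSize (ModAddU.MFI.symmLines K (Mul.Rw L (Mk1 L o k) L) ((U L o k L).s) L) ≤ L * (K.size + 10) := by
    unfold ModAddU.MFI.symmLines; exact proofSize_mapL (B := K.size + 10) fun i _ => by simp [ctx, eqv, size, FregeSystem.size_biimp]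
  have h6 : proofSize (ModAddU.MFI.transLines K (Mul.Rw L (MP L o) (k + 1)) (Mul.Rw L (MQ L o (k + 1)) L) L) ≤ L * (K.size + 10) := by
    unfold ModAddU.MFI.transLines; exact proofSize_mapL (B := K.size + 10) fun i _ => by simp [ctx, eqv, size, FregeSystem.size_biimp]
  unfold stepLines
  simp only [proofSize_append]
  nlinarith

/-- **Size of the commutativity law**: `≤ 80 (L+1)³ (|K| + 130)`. [folklore] -/
theorem proofSize_lines (L : ℕ) (o : Occ) (K : PropForm ℕ) : proofSize (lines L o K) ≤ 80 * ((L + 1) * (L + 1) * (L + 1)) * (K.size + 130) := by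
  have hK := Nat.zero_le K.size
  have hb : proofSize (baseLines L o K) ≤ L * ((9 * L + 2) * (K.size + 20)) + L * (K.size + 10) := by
    unfold baseLines; rw [proofSize_append]
    have h1 := HZ.proofSize_mulLines L (MQ L o 0) K 0 0
    have h2 : proofSize ((List.range L).map fun i => ctx K (eqv (Mul.Rw L (MP L o) 0 i) (Mul.Rw L (MQ L o 0) L i))) ≤ L * (K.size + 10) :=
      proofSize_mapL (B := K.size + 10) fun i _ => by simp [ctx, eqv, size, FregeSystem.size_biimp]
    omega
  have h : ∀ k ≤ L, proofSize (commUpTo L o K k) ≤ L * ((9 * L + 2) * (K.size + 20)) + L * (K.size + 10) + k * (66 * ((L + 1) * (L + 1)) * (K.size + 130)) := by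
    intro k hk
    induction k with
    | zero => simpa [commUpTo] using hb
    | succ k ih => rw [commUpTo, proofSize_append]; nlinarith [ih (by omega), proofSize_stepLines L o K k (by omega)]
  exact (h L le_rfl).trans (by nlinarith)

end CommLaw

end Plain

end Literature.Computability.MetaComplexity
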